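import Mathlib

/-!
# Piecewise-linear reparametrisations of the circle through prescribed knots

Support file for `RectilinearSuffices` (route CardyBoundaryCoulombGas of `CardyFormulaZ2`,
item stmt-CriticalPhenomena-5663). Given `M ≥ 1` knots `θ 0 < θ 1 < ⋯ < θ (M-1) < θ 0 + 1`, there
is an increasing homeomorphism `ρ` of `ℝ` commuting with the unit translation and sending `θ i`
to `i / M` (`exists_reparam`). It is obtained as the inverse of the lift `g` of degree one which
is affine on each `[i/M, (i+1)/M]` with `g (i/M) = θ i`; `g` is strictly increasing and
surjective, hence an order isomorphism of `ℝ`, hence a homeomorphism. Precomposing a standard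
closed polygon `polygonLoop l` (knots `i/M`) with `ρ` re-times it so as to pass through its
`i`-th vertex at time `θ i`.
-/

namespace Summit.CriticalPhenomena.CardyFormulaZ2.Theorems

open Set

/-- **Reparametrisation through prescribed knots.** See the module docstring. [folklore] -/
theorem exists_reparam {M : ℕ} (hM : 0 < M) (θ : ℕ → ℝ) (hθ : ∀ i, i + 1 < M → θ i < θ (i + 1))
    (hwrap : θ (M - 1) < θ 0 + 1) :
    ∃ ρ : ℝ → ℝ, Continuous ρ ∧ StrictMono ρ ∧ Function.Surjective ρ ∧ (∀ s, ρ (s + 1) = ρ s + 1) ∧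
      ∀ i, i < M → ρ (θ i) = (i : ℝ) / M := by
  set Mz : ℤ := (M : ℤ) with hMz
  have hMz0 : 0 < Mz := by rw [hMz]; exact_mod_cast hM
  have hMr : (0 : ℝ) < M := by exact_mod_cast hM
  -- the lifted knot sequence on `ℤ`
  set Θ : ℤ → ℝ := fun n => θ (n % Mz).toNat + ((n / Mz : ℤ) : ℝ) with hΘ
  have hdec : ∀ n : ℤ, 0 ≤ n % Mz ∧ n % Mz < Mz ∧ n % Mz + Mz * (n / Mz) = n := fun n =>
    ⟨Int.emod_nonneg _ hMz0.ne', Int.emod_lt_of_pos _ hMz0, Int.emod_add_mul_ediv n Mz⟩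
  have hΘM : ∀ n : ℤ, Θ (n + Mz) = Θ n + 1 := by
    intro n
    obtain ⟨h0, h1, h2⟩ := hdec n
    have key : (n + Mz) / Mz = n / Mz + 1 ∧ (n + Mz) % Mz = n % Mz :=
      (Int.ediv_emod_unique hMz0).2 ⟨by linarith, h0, h1⟩
    simp only [hΘ, key.1, key.2, Int.cast_add, Int.cast_one]
    ring
  have hΘnat : ∀ i : ℕ, i < M → Θ i = θ i := by
    intro i hi
    have key : (i : ℤ) / Mz = 0 ∧ (i : ℤ) % Mz = i :=
      (Int.ediv_emod_unique hMz0).2 ⟨by ring, by positivity, by rw [hMz]; exact_mod_cast hi⟩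
    simp only [hΘ, key.1, key.2, Int.toNat_natCast, Int.cast_zero, add_zero]
  have hΘsucc : ∀ n : ℤ, Θ n < Θ (n + 1) := by
    intro n
    obtain ⟨h0, h1, h2⟩ := hdec n
    set r := n % Mz with hr
    set k := n / Mz with hk
    have hrnat : ((r.toNat : ℕ) : ℤ) = r := Int.toNat_of_nonneg h0
    by_cases hlt : r + 1 < Mz
    · have key : (n + 1) / Mz = k ∧ (n + 1) % Mz = r + 1 :=
        (Int.ediv_emod_unique hMz0).2 ⟨by linarith, by linarith, hlt⟩
      have htn : (r + 1).toNat = r.toNat + 1 := by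
        have : ((r + 1).toNat : ℤ) = r.toNat + 1 := by
          rw [Int.toNat_of_nonneg (by linarith), hrnat]
        exact_mod_cast this
      have hrM : r.toNat + 1 < M := by
        have : (r.toNat : ℤ) + 1 < Mz := by rw [hrnat]; exact hlt
        rw [hMz] at this; exact_mod_cast this
      show θ (n % Mz).toNat + ((n / Mz : ℤ) : ℝ) < θ ((n + 1) % Mz).toNat + (((n + 1) / Mz : ℤ) : ℝ)
      rw [key.1, key.2, ← hr, ← hk, htn]
      linarith [hθ _ hrM]
    · have hrM : r + 1 = Mz := le_antisymm (by linarith) (not_lt.1 hlt)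
      have key : (n + 1) / Mz = k + 1 ∧ (n + 1) % Mz = 0 :=
        (Int.ediv_emod_unique hMz0).2 ⟨by rw [mul_add, mul_one, zero_add, ← h2]; linarith,
          le_rfl, hMz0⟩
      have htn : r.toNat = M - 1 := by
        have : (r.toNat : ℤ) = (M : ℤ) - 1 := by rw [hrnat]; linarith
        omega
      show θ (n % Mz).toNat + ((n / Mz : ℤ) : ℝ) < θ ((n + 1) % Mz).toNat + (((n + 1) / Mz : ℤ) : ℝ)
      rw [key.1, key.2, ← hr, ← hk, htn, Int.toNat_zero, Int.cast_add, Int.cast_one]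
      linarith
  have hΘmono : StrictMono Θ := strictMono_int_of_lt_succ hΘsucc
  -- the lift `g`
  set g : ℝ → ℝ := fun x => Θ ⌊(M : ℝ) * x⌋ + ((M : ℝ) * x - ⌊(M : ℝ) * x⌋) *
    (Θ (⌊(M : ℝ) * x⌋ + 1) - Θ ⌊(M : ℝ) * x⌋) with hg
  have hfrac : ∀ x : ℝ, 0 ≤ (M : ℝ) * x - ⌊(M : ℝ) * x⌋ ∧ (M : ℝ) * x - ⌊(M : ℝ) * x⌋ < 1 := fun x =>
    ⟨by linarith [Int.floor_le ((M : ℝ) * x)], by linarith [Int.lt_floor_add_one ((M : ℝ) * x)]⟩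
  have hg_lt : ∀ x, g x < Θ (⌊(M : ℝ) * x⌋ + 1) := fun x => by
    have := hΘsucc ⌊(M : ℝ) * x⌋
    have hf := hfrac x
    simp only [hg]
    nlinarith
  have hg_ge : ∀ x, Θ ⌊(M : ℝ) * x⌋ ≤ g x := fun x => by
    have := hΘsucc ⌊(M : ℝ) * x⌋
    have hf := hfrac x
    simp only [hg]
    nlinarith
  have hmono : StrictMono g := by
    intro x y hxy
    have hMxy : (M : ℝ) * x < (M : ℝ) * y := mul_lt_mul_of_pos_left hxy hMr
    have hfl : ⌊(M : ℝ) * x⌋ ≤ ⌊(M : ℝ) * y⌋ := Int.floor_mono hMxy.le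
    rcases lt_or_eq_of_le hfl with h | h
    · calc g x < Θ (⌊(M : ℝ) * x⌋ + 1) := hg_lt x
        _ ≤ Θ ⌊(M : ℝ) * y⌋ := hΘmono.monotone (by omega)
        _ ≤ g y := hg_ge y
    · have hΔ := hΘsucc ⌊(M : ℝ) * y⌋
      simp only [hg, h]
      nlinarith
  have hper : ∀ x, g (x + 1) = g x + 1 := by
    intro x
    have hfl : ⌊(M : ℝ) * (x + 1)⌋ = ⌊(M : ℝ) * x⌋ + Mz := by
      rw [mul_add, mul_one, Int.floor_add_natCast]
    simp only [hg, hfl]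
    rw [show ⌊(M : ℝ) * x⌋ + Mz + 1 = ⌊(M : ℝ) * x⌋ + 1 + Mz by ring, hΘM, hΘM]
    push_cast
    rw [hMz]; push_cast
    ring
  have hknot : ∀ i, i < M → g ((i : ℝ) / M) = θ i := by
    intro i hi
    have h1 : (M : ℝ) * ((i : ℝ) / M) = (i : ℝ) := mul_div_cancel₀ _ hMr.ne'
    have h2 : ⌊((i : ℕ) : ℝ)⌋ = (i : ℤ) := Int.floor_natCast i
    simp only [hg, h1, h2, Int.cast_natCast, sub_self, zero_mul, add_zero]
    exact hΘnat i hi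
  -- surjectivity
  have hΘshift : ∀ (k : ℕ) (n : ℤ), Θ (n + Mz * k) = Θ n + k := by
    intro k
    induction k with
    | zero => intro n; simp
    | succ k ih =>
      intro n
      rw [show n + Mz * ((k + 1 : ℕ) : ℤ) = (n + Mz * k) + Mz by push_cast; ring, hΘM, ih]
      push_cast; ring
  have hΘ0 : Θ 0 = θ 0 := by
    have := hΘnat 0 hM
    simpa using this
  have hsurj : Function.Surjective g := by
    intro y
    -- the last knot below `y`
    obtain ⟨ub, hub, hmax⟩ := Int.exists_greatest_of_bdd (P := fun n => Θ n ≤ y)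
      (by
        refine ⟨Mz * (⌈y - θ 0⌉.toNat + 1 : ℕ), fun z hz => ?_⟩
        by_contra hlt
        push Not at hlt
        have h1 : Θ (Mz * (⌈y - θ 0⌉.toNat + 1 : ℕ)) ≤ Θ z := hΘmono.monotone hlt.le
        have h2 := hΘshift (⌈y - θ 0⌉.toNat + 1) 0
        rw [zero_add, hΘ0] at h2
        rw [h2] at h1
        have h3 : y - θ 0 ≤ (⌈y - θ 0⌉.toNat : ℝ) := by
          have := Int.le_ceil (y - θ 0)
          have h4 : (⌈y - θ 0⌉ : ℝ) ≤ ((⌈y - θ 0⌉.toNat : ℤ) : ℝ) := by exact_mod_cast Int.self_le_toNat _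
          push_cast at h4; linarith
        push_cast at h1
        linarith [hz])
      (by
        refine ⟨-(Mz * (⌈θ 0 - y⌉.toNat + 1 : ℕ)), ?_⟩
        have h2 := hΘshift (⌈θ 0 - y⌉.toNat + 1) (-(Mz * (⌈θ 0 - y⌉.toNat + 1 : ℕ)))
        rw [neg_add_cancel, hΘ0] at h2
        have h3 : θ 0 - y ≤ (⌈θ 0 - y⌉.toNat : ℝ) := by
          have := Int.le_ceil (θ 0 - y)
          have h4 : (⌈θ 0 - y⌉ : ℝ) ≤ ((⌈θ 0 - y⌉.toNat : ℤ) : ℝ) := by exact_mod_cast Int.self_le_toNat _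
          push_cast at h4; linarith
        show Θ _ ≤ y
        push_cast at h2 ⊢
        linarith)
    have hub1 : y < Θ (ub + 1) := by
      by_contra h
      have := hmax (ub + 1) (not_lt.1 h)
      omega
    set Δ := Θ (ub + 1) - Θ ub with hΔ
    have hΔpos : 0 < Δ := by rw [hΔ]; linarith [hΘsucc ub]
    set f := (y - Θ ub) / Δ with hf
    have hf0 : 0 ≤ f := div_nonneg (by linarith) hΔpos.le
    have hf1 : f < 1 := (div_lt_one hΔpos).2 (by rw [hΔ]; linarith)
    refine ⟨((ub : ℝ) + f) / M, ?_⟩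
    have h1 : (M : ℝ) * (((ub : ℝ) + f) / M) = ub + f := mul_div_cancel₀ _ hMr.ne'
    have h2 : ⌊(ub : ℝ) + f⌋ = ub := by
      rw [Int.floor_intCast_add, Int.floor_eq_zero_iff.2 ⟨hf0, hf1⟩, add_zero]
    simp only [hg, h1, h2]
    rw [show (ub : ℝ) + f - ub = f by ring, hf, ← hΔ]
    field_simp
    ring
  -- the inverse order isomorphism
  set e := StrictMono.orderIsoOfSurjective g hmono hsurj with he
  have heg : ∀ x, e x = g x := fun x => rfl
  refine ⟨e.symm, e.symm.continuous, e.symm.strictMono, e.symm.surjective, fun s => ?_, fun i hi => ?_⟩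
  · apply e.injective
    rw [e.apply_symm_apply, heg, hper, ← heg, e.apply_symm_apply]
  · apply e.injective
    rw [e.apply_symm_apply, heg, hknot i hi]

end Summit.CriticalPhenomena.CardyFormulaZ2.Theorems
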